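import Mathlib.Analysis.SpecificLimits.Basic
import Literature.Computability.Cryptography.PseudorandomnessProofs
import Literature.Computability.Cryptography.PRGStretchExtensionReduction
import Literature.Computability.Cryptography.PseudorandomGeneratorsAnyOWF
import Literature.Computability.Cryptography.GGM
import Literature.Computability.MetaComplexity.DistProblems
import Literature.Computability.Complexity.PairProjections
import Literature.Computability.Complexity.StringEquality
import Literature.Computability.Complexity.TimeBoundsProofs
import Literature.Probability.LatticeModels.IndependencePolynomial

/-!
# PRG-image source twins (stub `stub_prgImageTwins` of line `prg-image-exact-threshold-lift`)

Crux `Summit.PneNP.PneNP.Theses.PhaseTwins.PseudorandomTwinsAbove` (item stmt-PneNP-2721), step S1.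
From `PRGExist` we build

* a pseudorandom generator `G` of the strictly monotone, polynomially bounded stretch
  `ℓ n = 2n + 1` (`exists_isPRG_succ_of_PRGExist`, then Goldreich's stretch extension
  `exists_isPRG_of_stretch_succ_holds` with `GGM.polyTimeComputable_two_mul_add_one`);
* the twins `X₀ n := G(U_n)` and `X₁ n := U_{2n+1}`, both exactly samplable (run `G` on the coins,
  resp. output the coins) and computationally indistinguishable (this IS pseudorandomness of `G`);
* the language `L := Im G`, which is in `NP` (witness: the seed; verifier: recompute `G` and compare,
  `setOf_apply_eq_apply_mem_P`), contains the support of every `X₀ n`, and has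
  `Pr_{U_{2n+1}}[L] ≤ 2ⁿ · 2^{-(2n+1)} ≤ (1/2)ⁿ → 0` (strings of length `2n + 1` in `Im G` come from
  the `2ⁿ` seeds of length exactly `n`).

No new definitions, no named facts; everything used is proved in the tree.
-/

set_option linter.dupNamespace false -- `Summit.PneNP.PneNP.…`: summit = sub-problem (D-0017)

namespace Summit.PneNP.PneNP.Theorems

open Filter
open Literature.Computability.Complexity Literature.Computability.MetaComplexity
open Literature.Computability.Cryptography (OWFExist PRGExist IsPRG IsCompIndistinguishable uniformBits
  PRGExist_of_OWFExist)
open Literature.Probability.LatticeModels (hardCoreThreshold)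
open _root_.Computability

namespace PrgImageTwins

/-- From `PRGExist`, a pseudorandom generator of the strictly monotone stretch `n ↦ 2n + 1`
(stretch `n + 1` by truncation, then Goldreich's stretch extension, Thm. 3.3.3). -/
theorem exists_isPRG_twiceSucc (h : PRGExist) : ∃ G, IsPRG G fun n => 2 * n + 1 :=
  Literature.Computability.Cryptography.exists_isPRG_of_stretch_succ_holds
    (Literature.Computability.Cryptography.exists_isPRG_succ_of_PRGExist h) (fun n => 2 * n + 1)
    ⟨2 * Polynomial.X + 1, fun n => by simp⟩ (fun n => by omega)
    Literature.Computability.Cryptography.GGM.polyTimeComputable_two_mul_add_one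

/-- Push-forwards of `U_{ℓ n}` along `FP` maps are exactly polynomial-time samplable when `ℓ` is
polynomially bounded: the sampler `⟨(n, r) ↦ g r, coinLen := ℓ⟩` runs `g` on its `ℓ n = ℓ |1ⁿ|`
coins (polynomial time: `g` after the second pair projection `⟨1ⁿ, r⟩ ↦ r`). -/
theorem isPolySamplable_map_uniformBits {g : List Bool → List Bool} (hg : g ∈ FP) {ℓ : ℕ → ℕ}
    (hℓ : ∃ p : Polynomial ℕ, ∀ n, ℓ n ≤ p.eval n) :
    Ensemble.IsPolySamplable fun n => (uniformBits (ℓ n)).map g := by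
  obtain ⟨p, M, hM⟩ :=
    (PolyTimeComputable.comp_holds hg boolUnpairSnd_mem_FP :
      PolyTimeComputable id id (g ∘ fun z => (boolUnpair z).2))
  obtain ⟨q, hq⟩ := hℓ
  refine ⟨⟨fun _ r => g r, ℓ⟩, ⟨⟨p, M, fun a => ?_⟩, q, hq⟩, fun n => ?_⟩
  · have h := hM (boolPair (unaryEncodeNat a.1) a.2)
    simp only [id, Function.comp_apply, boolUnpair_boolPair] at h
    exact h
  · have hn : (unaryEncodeNat n).length = n := unary_decode_encode_nat n
    change (PMF.uniformOfFintype (List.Vector Bool (ℓ (unaryEncodeNat n).length))).map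
        (fun r => g r.toList) = (uniformBits (ℓ n)).map g
    rw [hn, uniformBits, PMF.map_comp]
    rfl

/-- The range of a polynomial-time map that does not shrink lengths is in `NP`: the witness for
`y` is a seed `s` with `G s = y` (so `|s| ≤ |y|`), and the verifier language
`{⟨y, s⟩ | G s = y}` is in `P` (recompute and compare, `setOf_apply_eq_apply_mem_P`). -/
theorem range_mem_NP {G : List Bool → List Bool} (hG : G ∈ FP)
    (hlen : ∀ s, s.length ≤ (G s).length) :
    ({y | ∃ s, G s = y} : Language Bool) ∈ Nondeterministic.NP := by
  refine ⟨{w | (G ∘ fun z => (boolUnpair z).2) w = (boolUnpair w).1},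
    setOf_apply_eq_apply_mem_P (PolyTimeComputable.comp_holds hG boolUnpairSnd_mem_FP)
      boolUnpairFst_mem_FP, Polynomial.X, fun y => ?_⟩
  have hmem : ∀ s : List Bool,
      boolPair y s ∈ ({w | (G ∘ fun z => (boolUnpair z).2) w = (boolUnpair w).1} : Language Bool) ↔
        G s = y := fun s => by
    change (G ∘ fun z => (boolUnpair z).2) (boolPair y s) = (boolUnpair (boolPair y s)).1 ↔ _
    rw [Function.comp_apply, boolUnpair_boolPair]
  change (∃ s, G s = y) ↔ _
  constructor
  · rintro ⟨s, rfl⟩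
    exact ⟨s, by rw [Polynomial.eval_X]; exact hlen s, (hmem s).2 rfl⟩
  · rintro ⟨s, -, hs⟩
    exact ⟨s, (hmem s).1 hs⟩

/-- Counting: a set of strings of length `2n + 1` inside the range of a map `G` with
`|G s| = 2|s| + 1` has at most `2ⁿ` elements (each comes from a seed of length exactly `n`). -/
theorem card_le_two_pow {G : List Bool → List Bool} (hlen : ∀ s, (G s).length = 2 * s.length + 1)
    (n : ℕ) (F : Finset (List.Vector Bool (2 * n + 1))) (hF : ∀ w ∈ F, ∃ s, G s = w.toList) :
    F.card ≤ 2 ^ n := by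
  classical
  have hlenv : ∀ v : List.Vector Bool n, (G v.toList).length = 2 * n + 1 := fun v => by
    rw [hlen, List.Vector.toList_length]
  calc F.card ≤ ((Finset.univ : Finset (List.Vector Bool n)).image
        fun v => (⟨G v.toList, hlenv v⟩ : List.Vector Bool (2 * n + 1))).card := by
        refine Finset.card_le_card fun w hw => ?_
        obtain ⟨s, hs⟩ := hF w hw
        have hsl : s.length = n := by
          have h := congrArg List.length hs
          rw [hlen, List.Vector.toList_length] at h
          omega
        exact Finset.mem_image.2 ⟨⟨s, hsl⟩, Finset.mem_univ _, List.Vector.toList_injective hs⟩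
    _ ≤ (Finset.univ : Finset (List.Vector Bool n)).card := Finset.card_image_le
    _ = 2 ^ n := by rw [Finset.card_univ, card_vector, Fintype.card_bool]

/-- `Pr_{U_{2n+1}}[E] ≤ 2ⁿ / 2^{2n+1} ≤ (1/2)ⁿ` for every event `E` inside the range of a map `G`
with `|G s| = 2|s| + 1`. -/
theorem prob_le_half_pow {G : List Bool → List Bool} (hlen : ∀ s, (G s).length = 2 * s.length + 1)
    (n : ℕ) (E : Set (List Bool)) (hE : ∀ y ∈ E, ∃ s, G s = y) :
    Ensemble.prob (fun n => uniformBits (2 * n + 1)) n E ≤ (1 / 2 : ℝ) ^ n := by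
  classical
  have h1 : Ensemble.prob (fun n => uniformBits (2 * n + 1)) n E = uniformProb (2 * n + 1) E :=
    prob_uniformEnsemble (2 * n + 1) E
  rw [h1]
  unfold uniformProb
  calc _ ≤ (2 : ℝ) ^ n / 2 ^ (2 * n + 1) := by
        gcongr
        exact_mod_cast card_le_two_pow hlen n _ fun w hw => hE _ (Finset.mem_filter.1 hw).2
    _ ≤ (1 / 2 : ℝ) ^ n := by
        rw [one_div_pow, div_le_div_iff₀ (by positivity) (by positivity), one_mul, ← pow_add]
        exact pow_le_pow_right₀ (by norm_num) (by omega)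

end PrgImageTwins

/-- **S1 — PRG-image source twins.** From a PRG obtain: an `NP` language `L`, a strictly monotone
polynomially bounded length map `ℓ`, and two EXACTLY samplable ensembles `X₀`, `X₁` supported on
`{0,1}^{ℓ n}`, computationally indistinguishable WITH the index (`IsCompIndistinguishable`, negligible
advantage), with `X₀ n` supported inside `L` and `Pr_{X₁ n}[L] → 0`. Proof: `PRGExist` gives a PRG
of stretch `n + 1` (`exists_isPRG_succ_of_PRGExist`) and then one, `G`, of stretch `ℓ n = 2n + 1`
(`exists_isPRG_of_stretch_succ_holds`); `X₀ n := G(U_n)`, `X₁ n := U_{2n+1}`, `L := Im G ∈ NP`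
(witness = seed), `Pr_{U_{2n+1}}[Im G] ≤ 2ⁿ · 2^{-(2n+1)} ≤ (1/2)ⁿ → 0`. -/
theorem stub_prgImageTwins : PRGExist →
    ∃ (L : Language Bool) (ℓ : ℕ → ℕ) (X₀ X₁ : Ensemble),
      L ∈ Nondeterministic.NP ∧ StrictMono ℓ ∧ (∃ P : Polynomial ℕ, ∀ n, ℓ n ≤ P.eval n) ∧
      X₀.IsPolySamplable ∧ X₁.IsPolySamplable ∧ IsCompIndistinguishable X₀ X₁ ∧
      (∀ n, ∀ s ∈ (X₀ n).support, s.length = ℓ n) ∧ (∀ n, ∀ s ∈ (X₁ n).support, s.length = ℓ n) ∧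
      (∀ n, ∀ s ∈ (X₀ n).support, s ∈ L) ∧
      Tendsto (fun n : ℕ => X₁.prob n {s | s ∈ L}) atTop (nhds 0) := by
  intro hPRG
  obtain ⟨G, hG⟩ := PrgImageTwins.exists_isPRG_twiceSucc hPRG
  have hpoly : ∃ P : Polynomial ℕ, ∀ n, 2 * n + 1 ≤ P.eval n := ⟨2 * Polynomial.X + 1, fun n => by simp⟩
  refine ⟨{y | ∃ s, G s = y}, fun n => 2 * n + 1, fun n => (uniformBits n).map G,
    fun n => uniformBits (2 * n + 1), PrgImageTwins.range_mem_NP hG.polyTimeComputable ?_,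
    fun a b hab => ?_, hpoly, ?_, ?_, hG.isPseudorandom, ?_, ?_, ?_, ?_⟩
  · intro s
    rw [hG.length_eq]
    omega
  · show 2 * a + 1 < 2 * b + 1
    omega
  · exact PrgImageTwins.isPolySamplable_map_uniformBits (ℓ := fun n => n) hG.polyTimeComputable
      ⟨Polynomial.X, fun n => by simp⟩
  · simpa only [PMF.map_id] using
      PrgImageTwins.isPolySamplable_map_uniformBits (PolyTimeComputable.id _) hpoly
  · intro n s hs
    obtain ⟨r, hr, rfl⟩ := (PMF.mem_support_map_iff _ _ _).1 hs
    rw [hG.length_eq,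
      Literature.Computability.Cryptography.PRGTrunc.length_eq_of_mem_support_uniformBits hr]
  · intro n s hs
    exact Literature.Computability.Cryptography.PRGTrunc.length_eq_of_mem_support_uniformBits hs
  · intro n s hs
    obtain ⟨r, -, rfl⟩ := (PMF.mem_support_map_iff _ _ _).1 hs
    exact ⟨r, rfl⟩
  · exact tendsto_of_tendsto_of_tendsto_of_le_of_le tendsto_const_nhds
      (tendsto_pow_atTop_nhds_zero_of_lt_one (by norm_num) (by norm_num))
      (fun n => Ensemble.prob_nonneg _ _ _)
      (fun n => PrgImageTwins.prob_le_half_pow hG.length_eq n _ fun y hy => hy)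

end Summit.PneNP.PneNP.Theorems
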